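import Summits.QuantumAdvantage.QuantumAdvantage.Theorems.CertDialG
import HarnessLib

/-!
# CertDial (H) — decomp-qadv lens-2 (structural dichotomy: special vs generic), generation 28, part 8/8

Part 8 of NODE «CertDial» (memo in part A's header and `NODE-g28.md`): §10 ★★★ THE ANTIPODE BEATS WEIGHT THREE.  The contrast to part G
(`five_lights`: every WINDOW-LOCAL answer map loses an odd-class input of weight `≤ 3`): reading ONE far bit suffices to survive weight 3.  For
`n ≡ 2 (mod 4)` the XOR-ANTIPODE strategy `z_b = x_{b+1} ⊕ x_{b+n/2}`, i.e. the AFFINE `𝔽₃`-strategy `P_b = X_{b+1} + X_{b+n/2}` (`xorAnti`,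
value `1` iff exactly one of the two read bits is on), WINS EVERY ODD-CLASS INPUT OF WEIGHT `≤ 3` (`xorAnti_perfect_three`).  Proof by the part-F
atlas: both read offsets `1` and `n/2` are ODD, so every lit position has the parity opposite to the bit it reads; a monochromatic input is won
because the count in `rel_mono_iff` is `2·wt ≡ 0`; the two-one input `1_{0,d,e}` (`d` even, `e` odd) is won because the electorate `E ∪ [0,d)` of
`rel_tri_iff` catches `d−1`, `e−1`, `e+n/2` always and `n/2`, `d+n/2` exactly when `d > n/2` — an odd count `3` or `5`
(`card_xor_mod_two` removes coincidences in pairs); general position by rotation (`xorAnti_equivariant`, `rel_rot`); every light input is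
one of the two shapes (`light_three_cases`).  Since `xorAnti` reads the antipode it is not parity-local (`xorAnti_not_parityLocal`), so the
weight-3 versions of the generic leaf are FALSE: `not_pGlobalFail_three : 1 ≤ D → ¬ PGlobalFail 2 D 3`, `not_genericLightFail_three`,
`not_affineLightFail_three`.
READING for the lineage (rung 0 = 27432 via `ParityDial.closes₃ : PGlobalFail 2 2 7 → OGlobalFail 2 2 7 → NoPerfectTwo3`): weight 3 separates
LOCAL (part G) from ANTIPODAL (this part); the generic leaf genuinely needs weight `≥ 5` (numerically no junta strategy survives weight 5 —
`NODE-g28.md`); nothing here proves or refutes the weight-7 leaves or 27432.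
`lean check` on the tree closure: rc 0, no warnings, no placeholders; axioms standard (`propext`, `Classical.choice`, `Quot.sound`).
-/

set_option linter.dupNamespace false
set_option linter.style.longLine false

noncomputable section
open scoped Classical

namespace Summit.QuantumAdvantage.QuantumAdvantage.Theorems.CertDial
open Finset
open Literature.Computability.QuantumComplexity Literature.Computability.QuantumComplexity.RingHLF
open Summit.QuantumAdvantage.AdviceFreeQNC0
open Literature.Computability.MetaComplexity Literature.Computability.MetaComplexity.Smolensky
open Summit.QuantumAdvantage.QuantumAdvantage.Theorems.LightDial (wt ind onesOf ind_onesOf wt_eq_card_onesOf oddZeros_ind_iff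
  mono_singleton_apply)
open Summit.QuantumAdvantage.QuantumAdvantage.Theorems.ParityDial (par offs IsParityLocal PGlobalFail)
open Summit.QuantumAdvantage.AdviceFreeQNC0.LightConeWindowHard (window window_apply)
open Summit.QuantumAdvantage.AdviceFreeQNC0.RingSymmetry (shift rot_apply rel_rot card_filter_shift shift_shift)

variable {n : ℕ}

/-! ### §10a Counting tools -/

/-- the parity of a XOR count is the sum of the two counts. -/
theorem card_xor_mod_two (E : Fin n → Prop) [DecidablePred E] (u v : Fin n → Bool) :
    (univ.filter fun b : Fin n => E b ∧ (u b ^^ v b) = true).card % 2 =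
      ((univ.filter fun b : Fin n => E b ∧ u b = true).card + (univ.filter fun b : Fin n => E b ∧ v b = true).card) % 2 := by
  have h : ∀ b : Fin n, Even ((if E b ∧ (u b ^^ v b) = true then 1 else 0) + (if E b ∧ u b = true then 1 else 0) +
      (if E b ∧ v b = true then 1 else 0) : ℕ) := by
    intro b
    by_cases hE : E b <;> cases hu : u b <;> cases hv : v b <;> simp [hE]
  have hs : Even (∑ b : Fin n, ((if E b ∧ (u b ^^ v b) = true then 1 else 0) + (if E b ∧ u b = true then 1 else 0) +
      (if E b ∧ v b = true then 1 else 0) : ℕ)) := Finset.even_sum _ fun b _ => h b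
  rw [Finset.sum_add_distrib, Finset.sum_add_distrib, ← Finset.card_filter, ← Finset.card_filter, ← Finset.card_filter, Nat.even_iff] at hs
  omega

/-- the value of a shifted position. -/
theorem val_shift (k : ℕ) (c : Fin n) : ((shift n k c : Fin n) : ℕ) = ((c : ℕ) + k) % n := rfl

/-- shifting by `n - k` undoes shifting by `k`. -/
theorem shift_sub_shift {k : ℕ} (hk : k ≤ n) (b : Fin n) : shift n (n - k) (shift n k b) = b := by
  apply Fin.ext
  have hb := b.isLt
  rw [shift_shift, val_shift, show k + (n - k) = n by omega, Nat.add_mod_right, Nat.mod_eq_of_lt hb]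

/-- re-indexing a count through a shifted read position. -/
theorem card_filter_and_shift (E : Fin n → Prop) [DecidablePred E] (x : Fin n → Bool) {k : ℕ} (hk : k ≤ n) :
    (univ.filter fun b : Fin n => E b ∧ x (shift n k b) = true).card =
      (univ.filter fun c : Fin n => E (shift n (n - k) c) ∧ x c = true).card := by
  rw [← card_filter_shift k (fun c : Fin n => E (shift n (n - k) c) ∧ x c = true)]
  exact congrArg Finset.card (Finset.filter_congr fun b _ => by rw [shift_sub_shift hk])

/-- counting over the support of the two-one input `1_{0,d,e}`. -/
theorem card_filter_and_tri (F : Fin n → Prop) [DecidablePred F] {d e : ℕ} (hd : 0 < d) (hde : d < e) (hen : e < n) :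
    (univ.filter fun c : Fin n => F c ∧ tri n d e c = true).card =
      (if F ⟨0, by omega⟩ then 1 else 0) + (if F ⟨d, by omega⟩ then 1 else 0) + (if F ⟨e, hen⟩ then 1 else 0) := by
  have hset : (univ.filter fun c : Fin n => F c ∧ tri n d e c = true) =
      (({(⟨0, by omega⟩ : Fin n), ⟨d, by omega⟩, ⟨e, hen⟩} : Finset (Fin n)).filter F) := by
    ext c
    simp only [mem_filter, mem_univ, true_and, mem_insert, mem_singleton, tri, decide_eq_true_eq, Fin.ext_iff]
    tauto
  rw [hset, Finset.card_filter, sum_insert, sum_insert, sum_singleton, add_assoc]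
  · simp only [mem_singleton, Fin.ext_iff]; omega
  · simp only [mem_insert, mem_singleton, Fin.ext_iff]; omega

/-- an odd shift flips the parity class (even `n`). -/
theorem par_shift_ne (he : n % 2 = 0) {k : ℕ} (hk : k % 2 = 1) (c : Fin n) : par (shift n k c) ≠ par c := by
  simp only [par, val_shift, ne_eq, decide_eq_decide]
  rw [Nat.mod_mod_of_dvd _ (Nat.dvd_of_mod_eq_zero he)]
  omega

/-! ### §10b The XOR-antipode strategy -/

/-- ★ the XOR-ANTIPODE strategy `P_b = X_{b+1} + X_{b+n/2}` over `𝔽₃`: answer `1` iff exactly one of `x_{b+1}`, `x_{b+n/2}` is on. -/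
def xorAnti (n : ℕ) : Fin n → CubeFn (ZMod 3) n := fun b =>
  mono (ZMod 3) ({shift n 1 b} : Finset (Fin n)) + mono (ZMod 3) ({shift n (n / 2) b} : Finset (Fin n))

/-- it is AFFINE. -/
theorem xorAnti_mem (b : Fin n) : xorAnti n b ∈ lowDeg (ZMod 3) n 1 :=
  Submodule.add_mem _ (mono_singleton_mem _) (mono_singleton_mem _)

/-- its answer bit is the XOR of the two read bits. -/
theorem xorAnti_eq_one_iff (b : Fin n) (x : Fin n → Bool) :
    xorAnti n b x = 1 ↔ (x (shift n 1 b) ^^ x (shift n (n / 2) b)) = true := by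
  simp only [xorAnti, Pi.add_apply, mono_singleton_apply]
  cases x (shift n 1 b) <;> cases x (shift n (n / 2) b) <;> decide

/-- its answer map. -/
theorem ans_xorAnti (x : Fin n → Bool) : ans (xorAnti n) x = fun b => x (shift n 1 b) ^^ x (shift n (n / 2) b) := by
  funext b
  unfold ans
  rw [Bool.eq_iff_iff, decide_eq_true_eq]
  exact xorAnti_eq_one_iff b x

/-- it is rotation-EQUIVARIANT. -/
theorem xorAnti_equivariant (k : ℕ) (x : Fin n → Bool) : ans (xorAnti n) (rot k x) = rot k (ans (xorAnti n) x) := by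
  rw [ans_xorAnti, ans_xorAnti]
  funext b
  simp only [rot_apply, shift_shift]
  rw [Nat.add_comm k 1, Nat.add_comm k (n / 2)]

/-! ### §10c It wins every light input when `n ≡ 2 (mod 4)` -/

/-- MONOCHROMATIC inputs (all ones of one parity, odd class — any weight) are won, at every even length: both read offsets are odd when
`n ≡ 2 (mod 4)`, so the count of `rel_mono_iff` is `wt x + wt x`. -/
theorem xorAnti_wins_mono (h4 : n % 4 = 2) (hn : 3 ≤ n) {x : Fin n → Bool} (hx : OddZeros x) {q : Bool}
    (hq : ∀ b, x b = true → par b = q) : Rel x (ans (xorAnti n) x) := by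
  have he : n % 2 = 0 := by omega
  rw [rel_mono_iff he hn hx hq, ans_xorAnti, card_xor_mod_two (fun b : Fin n => par b ≠ q),
    card_filter_and_shift _ _ (show 1 ≤ n by omega), card_filter_and_shift _ _ (show n / 2 ≤ n by omega)]
  have hA : ∀ {k : ℕ}, k % 2 = 1 →
      (univ.filter fun c : Fin n => par (shift n k c) ≠ q ∧ x c = true).card = (univ.filter fun c : Fin n => x c = true).card := by
    intro k hk
    exact congrArg Finset.card (Finset.filter_congr fun c _ =>
      ⟨fun h => h.2, fun h => ⟨by rw [← hq c h]; exact par_shift_ne he hk c, h⟩⟩)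
  rw [hA (show (n - 1) % 2 = 1 by omega), hA (show (n - n / 2) % 2 = 1 by omega)]
  omega

/-- the normalised TWO-ONE input `1_{0,d,e}` (`d` even, `e` odd, `2 ≤ d < e < n`) is won when `n ≡ 2 (mod 4)`: the electorate `E ∪ [0,d)`
catches `d − 1`, `e − 1`, `e + n/2` always, and `n/2`, `d + n/2` exactly when `d > n/2` — an odd number. -/
theorem xorAnti_wins_tri (h4 : n % 4 = 2) {d e : ℕ} (hd2 : d % 2 = 0) (he2 : e % 2 = 1) (hd : 2 ≤ d) (hde : d < e) (hen : e < n) :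
    Rel (tri n d e) (ans (xorAnti n) (tri n d e)) := by
  have he : n % 2 = 0 := by omega
  have hn : 3 ≤ n := by omega
  rw [rel_tri_iff he hn hd2 he2 hd hde hen, ans_xorAnti, card_xor_mod_two (fun b : Fin n => (b : ℕ) % 2 = 0 ∨ (b : ℕ) < d),
    card_filter_and_shift _ _ (show 1 ≤ n by omega), card_filter_and_shift _ _ (show n / 2 ≤ n by omega),
    card_filter_and_tri _ (by omega) hde hen, card_filter_and_tri _ (by omega) hde hen]
  simp only [val_shift]
  -- the six read-back positions, as plain numbers
  have e1 : (0 + (n - 1)) % n = n - 1 := by rw [Nat.zero_add]; exact Nat.mod_eq_of_lt (by omega)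
  have e2 : (d + (n - 1)) % n = d - 1 := by rw [show d + (n - 1) = (d - 1) + n by omega, Nat.add_mod_right, Nat.mod_eq_of_lt (by omega)]
  have e3 : (e + (n - 1)) % n = e - 1 := by rw [show e + (n - 1) = (e - 1) + n by omega, Nat.add_mod_right, Nat.mod_eq_of_lt (by omega)]
  have e4 : (0 + (n - n / 2)) % n = n / 2 := by rw [show 0 + (n - n / 2) = n / 2 by omega, Nat.mod_eq_of_lt (by omega)]
  have e6 : ((e + (n - n / 2)) % n) % 2 = 0 ∧ True := by
    refine ⟨?_, trivial⟩
    rw [Nat.mod_mod_of_dvd _ (Nat.dvd_of_mod_eq_zero he)]; omega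
  have f1 : ¬ ((n - 1) % 2 = 0 ∨ n - 1 < d) := by omega
  have f2 : (d - 1) % 2 = 0 ∨ d - 1 < d := Or.inr (by omega)
  have f3 : (e - 1) % 2 = 0 ∨ e - 1 < d := Or.inl (by omega)
  have f6 : (e + (n - n / 2)) % n % 2 = 0 ∨ (e + (n - n / 2)) % n < d := Or.inl e6.1
  by_cases hdh : n / 2 < d
  · have e5 : (d + (n - n / 2)) % n = d - n / 2 := by
      rw [show d + (n - n / 2) = (d - n / 2) + n by omega, Nat.add_mod_right, Nat.mod_eq_of_lt (by omega)]
    have f4 : (n / 2) % 2 = 0 ∨ n / 2 < d := Or.inr hdh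
    have f5 : (d - n / 2) % 2 = 0 ∨ d - n / 2 < d := Or.inr (by omega)
    simp only [e1, e2, e3, e4, e5, f1, f2, f3, f4, f5, f6, if_true, if_false]
  · have e5 : (d + (n - n / 2)) % n = d + n / 2 := by
      rw [show d + (n - n / 2) = d + n / 2 by omega, Nat.mod_eq_of_lt (by omega)]
    have f4 : ¬ ((n / 2) % 2 = 0 ∨ n / 2 < d) := by omega
    have f5 : ¬ ((d + n / 2) % 2 = 0 ∨ d + n / 2 < d) := by omega
    simp only [e1, e2, e3, e4, e5, f1, f2, f3, f4, f5, f6, if_true, if_false]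

/-- … hence every two-one input in general position (rotation equivariance). -/
theorem xorAnti_wins_triAt (h4 : n % 4 = 2) (i : Fin n) {d e : ℕ} (hd2 : d % 2 = 0) (he2 : e % 2 = 1) (hd : 2 ≤ d) (hde : d < e)
    (hen : e < n) : Rel (triAt i d e) (ans (xorAnti n) (triAt i d e)) := by
  rw [triAt_eq_rot, xorAnti_equivariant, rel_rot]
  exact xorAnti_wins_tri h4 hd2 he2 hd hde hen

/-! ### §10d Every light input is monochromatic or a rotated two-one input -/

/-- `offs` is injective in the position. -/
theorem offs_eq_offs_iff (b c i : Fin n) : offs b i = offs c i ↔ b = c := by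
  constructor
  · intro h
    apply Fin.ext
    have hb := b.isLt; have hc := c.isLt
    unfold offs at h
    split_ifs at h <;> omega
  · rintro rfl; rfl

/-- a pair of one parity and a single of the other parity: the input is a rotated two-one input. -/
theorem triAt_of_pair (he : n % 2 = 0) {x : Fin n → Bool} {p₁ p₂ s : Fin n} (h12 : p₁ ≠ p₂) (hp : par p₁ = par p₂)
    (hs : par s ≠ par p₁) (hx : ∀ b, x b = true ↔ (b = p₁ ∨ b = p₂ ∨ b = s)) :
    ∃ i : Fin n, ∃ d e : ℕ, d % 2 = 0 ∧ e % 2 = 1 ∧ 2 ≤ d ∧ d < e ∧ e < n ∧ x = triAt i d e := by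
  have h1 := p₁.isLt; have h2 := p₂.isLt; have h3 := s.isLt
  have hv12 : (p₁ : ℕ) ≠ p₂ := fun h => h12 (Fin.ext h)
  have hpar12 : (p₁ : ℕ) % 2 = (p₂ : ℕ) % 2 := by
    simp only [par, decide_eq_decide] at hp; omega
  have hpars : (s : ℕ) % 2 ≠ (p₁ : ℕ) % 2 := by
    simp only [par, ne_eq, decide_eq_decide] at hs; omega
  have key : ∀ (i : Fin n) (d e : ℕ), (i = p₁ ∨ i = p₂) → d = offs (if i = p₁ then p₂ else p₁) i → e = offs s i → d < e →
      ∃ i : Fin n, ∃ d e : ℕ, d % 2 = 0 ∧ e % 2 = 1 ∧ 2 ≤ d ∧ d < e ∧ e < n ∧ x = triAt i d e := by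
    intro i d e hi hd hee hde
    have hdpar : d % 2 = 0 := by
      rw [hd, offs_mod_two_iff he]; rcases hi with rfl | rfl
      · rw [if_pos rfl]; exact hp.symm
      · rw [if_neg (Ne.symm h12)]; exact hp
    have hepar : e % 2 = 1 := by
      have : ¬ (e % 2 = 0) := by
        rw [hee, offs_mod_two_iff he]; rcases hi with rfl | rfl
        · exact hs
        · rw [← hp]; exact hs
      omega
    have hd0 : d ≠ 0 := by
      rw [hd]; rcases hi with rfl | rfl
      · rw [if_pos rfl]; intro h0
        exact h12 ((offs_eq_offs_iff p₂ i i).1 (by rw [h0]; unfold offs; simp)).symm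
      · rw [if_neg (Ne.symm h12)]; intro h0
        exact h12 ((offs_eq_offs_iff p₁ i i).1 (by rw [h0]; unfold offs; simp))
    have hen : e < n := by rw [hee]; unfold offs; split_ifs <;> omega
    refine ⟨i, d, e, hdpar, hepar, by omega, hde, hen, ?_⟩
    funext b
    rw [Bool.eq_iff_iff, hx b, triAt, decide_eq_true_eq]
    have h0 : offs b i = 0 ↔ b = i := by
      rw [← offs_eq_offs_iff b i i]; unfold offs; simp
    rw [h0, hd, hee, offs_eq_offs_iff, offs_eq_offs_iff]
    rcases hi with rfl | rfl
    · rw [if_pos rfl]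
    · rw [if_neg (Ne.symm h12)]; tauto
  by_cases hlt : offs p₂ p₁ < offs s p₁
  · exact key p₁ _ _ (Or.inl rfl) (by rw [if_pos rfl]) rfl hlt
  · refine key p₂ _ _ (Or.inr rfl) (by rw [if_neg (Ne.symm h12)]) rfl ?_
    have hne : offs p₂ p₁ ≠ offs s p₁ := fun h => by
      have := (offs_eq_offs_iff p₂ s p₁).1 h; subst this; exact hs hp.symm
    unfold offs at hlt hne ⊢
    split_ifs at hlt hne ⊢ <;> omega

/-- ★ CLASSIFICATION: at even length an odd-class input of weight `≤ 3` is monochromatic or a rotated two-one input `triAt i d e`. -/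
theorem light_three_cases (he : n % 2 = 0) {x : Fin n → Bool} (hx : OddZeros x) (hw : LightDial.wt x ≤ 3) :
    (∃ q : Bool, ∀ b, x b = true → par b = q) ∨
      ∃ i : Fin n, ∃ d e : ℕ, d % 2 = 0 ∧ e % 2 = 1 ∧ 2 ≤ d ∧ d < e ∧ e < n ∧ x = triAt i d e := by
  have hxA : x = ind (onesOf x) := (ind_onesOf x).symm
  have hmem : ∀ b, x b = true ↔ b ∈ onesOf x := fun b => by simp [onesOf]
  rw [hxA, oddZeros_ind_iff] at hx
  rw [wt_eq_card_onesOf] at hw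
  have hcard : (onesOf x).card = 1 ∨ (onesOf x).card = 3 := by omega
  rcases hcard with h1 | h3
  · obtain ⟨a, ha⟩ := Finset.card_eq_one.1 h1
    exact Or.inl ⟨par a, fun b hb => by rw [hmem, ha, mem_singleton] at hb; rw [hb]⟩
  · obtain ⟨a, b, c, hab, hac, hbc, habc⟩ := Finset.card_eq_three.1 h3
    have hx' : ∀ y, x y = true ↔ (y = a ∨ y = b ∨ y = c) := fun y => by
      rw [hmem, habc, mem_insert, mem_insert, mem_singleton]
    by_cases hpab : par a = par b
    · by_cases hpac : par a = par c
      · exact Or.inl ⟨par a, fun y hy => by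
          rcases (hx' y).1 hy with rfl | rfl | rfl
          · rfl
          · exact hpab.symm
          · exact hpac.symm⟩
      · exact Or.inr (triAt_of_pair he hab hpab (fun h' => hpac h'.symm) hx')
    · by_cases hpac : par a = par c
      · exact Or.inr (triAt_of_pair he hac hpac (fun h' => hpab h'.symm) fun y => by rw [hx' y]; tauto)
      · have hpbc : par b = par c := by
          revert hpab hpac
          cases par a <;> cases par b <;> cases par c <;> decide
        exact Or.inr (triAt_of_pair he hbc hpbc (fun h' => hpab h') fun y => by rw [hx' y]; tauto)

/-- ★★★ THE ANTIPODE BEATS WEIGHT THREE: for `n ≡ 2 (mod 4)` the affine XOR-antipode strategy wins EVERY odd-class input of weight `≤ 3`. -/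
theorem xorAnti_perfect_three (h4 : n % 4 = 2) (hn : 3 ≤ n) {x : Fin n → Bool} (hx : OddZeros x) (hw : LightDial.wt x ≤ 3) :
    Rel x (ans (xorAnti n) x) := by
  rcases light_three_cases (by omega) hx hw with ⟨q, hq⟩ | ⟨i, d, e, hd2, he2, hd, hde, hen, rfl⟩
  · exact xorAnti_wins_mono h4 hn hx hq
  · exact xorAnti_wins_triAt h4 i hd2 he2 hd hde hen

/-! ### §10e It is generic, so the weight-3 generic leaves are false -/

/-- `xorAnti` is NOT parity-local of radius `2` (`n ≡ 2 (mod 4)`, `n ≥ 10`): on the input `e_{n/2}` positions `0` and `2` see the same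
(empty) window but answer differently. -/
theorem xorAnti_not_parityLocal (h4 : n % 4 = 2) (hn : 10 ≤ n) : ¬ IsParityLocal 2 (xorAnti n) := by
  intro hP
  have h0 : 0 < n := by omega
  have h2 : 2 < n := by omega
  have hw : window 2 (lightPt n (n / 2)) ⟨0, h0⟩ = window 2 (lightPt n (n / 2)) ⟨2, h2⟩ := by
    funext d
    have hd := d.isLt
    rw [window_apply 2 (by omega), window_apply 2 (by omega)]
    simp only [lightPt, decide_eq_decide]
    split_ifs <;> omega
  have x1 : lightPt n (n / 2) (shift n 1 ⟨0, h0⟩) = false := by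
    simp only [lightPt, val_shift]; exact decide_eq_false (by rw [Nat.mod_eq_of_lt (by omega)]; omega)
  have x2 : lightPt n (n / 2) (shift n (n / 2) ⟨0, h0⟩) = true := by
    simp only [lightPt, val_shift]; exact decide_eq_true (by rw [Nat.mod_eq_of_lt (by omega)]; omega)
  have x3 : lightPt n (n / 2) (shift n 1 ⟨2, h2⟩) = false := by
    simp only [lightPt, val_shift]; exact decide_eq_false (by rw [Nat.mod_eq_of_lt (by omega)]; omega)
  have x4 : lightPt n (n / 2) (shift n (n / 2) ⟨2, h2⟩) = false := by
    simp only [lightPt, val_shift]; exact decide_eq_false (by rw [Nat.mod_eq_of_lt (by omega)]; omega)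
  have key := (hP (lightPt n (n / 2)) ⟨0, h0⟩ ⟨2, h2⟩ (by simp [par]) hw).1
  rw [xorAnti_eq_one_iff, xorAnti_eq_one_iff, x1, x2, x3, x4] at key
  exact Bool.false_ne_true (key rfl)

/-- ★★★ THE WEIGHT-3 GENERIC LEAF IS FALSE: for every degree bound `D ≥ 1`, `¬ PGlobalFail 2 D 3` — at every `n ≡ 2 (mod 4)` the affine,
non-parity-local `xorAnti` wins all odd-class inputs of weight `≤ 3`.  (The leaf of the lineage is `PGlobalFail 2 2 7`; weight 5 is open.) -/
theorem not_pGlobalFail_three {D : ℕ} (hD : 1 ≤ D) : ¬ PGlobalFail 2 D 3 := by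
  intro h
  obtain ⟨n₀, hn₀⟩ := pGlobalFail_anti_degree hD h
  obtain ⟨x, hx, hw, hrel⟩ := hn₀ (4 * (n₀ + 3) + 2) (by omega) (by omega) (xorAnti _) (fun i => xorAnti_mem i)
    (xorAnti_not_parityLocal (by omega) (by omega))
  exact hrel (xorAnti_perfect_three (by omega) (by omega) hx hw)

/-- … in the language of the node: no generic class of degree `≥ 1` fails at weight 3. -/
theorem not_genericLightFail_three {D : ℕ} (hD : 1 ≤ D) : ¬ GenericLightFail D 3 := fun h => not_pGlobalFail_three hD h.1

/-- … in particular the affine rung at weight 3 is false (`AffineLightFail 7` stays NECESSARY for the lineage, part D). -/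
theorem not_affineLightFail_three : ¬ AffineLightFail 3 := not_genericLightFail_three le_rfl

/-! ### Axiom audit -/

/-- info: 'Summit.QuantumAdvantage.QuantumAdvantage.Theorems.CertDial.xorAnti_perfect_three' depends on axioms: [propext,
 Classical.choice,
 Quot.sound] -/
#guard_msgs in #print axioms xorAnti_perfect_three

/-- info: 'Summit.QuantumAdvantage.QuantumAdvantage.Theorems.CertDial.not_pGlobalFail_three' depends on axioms: [propext,
 Classical.choice,
 Quot.sound] -/
#guard_msgs in #print axioms not_pGlobalFail_three

/-- info: 'Summit.QuantumAdvantage.QuantumAdvantage.Theorems.CertDial.light_three_cases' depends on axioms: [propext,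
 Classical.choice,
 Quot.sound] -/
#guard_msgs in #print axioms light_three_cases

end Summit.QuantumAdvantage.QuantumAdvantage.Theorems.CertDial
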